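import Mathlib
import HarnessLib
import Summits.NavierStokesRegularity.NavierStokesRegularity.Theorems.HalfSpaceWindowDoorCirculationCarryingRigidityDefs
import Summits.NavierStokesRegularity.NavierStokesRegularity.Theorems.PoloidalWindowDoorPoloidalWindowRigidityWindow
import Summits.NavierStokesRegularity.NavierStokesRegularity.Theorems.PoloidalWindowDoorPoloidalWindowRigidityForwardSmallness
import Summits.NavierStokesRegularity.NavierStokesRegularity.Theorems.SqueezeCycleExtremalElementExistsExtraction
import Summits.NavierStokesRegularity.NavierStokesRegularity.Theorems.SymmetryModuliCountSymmetricLiouvillePeriodicBlowdown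
import Summits.NavierStokesRegularity.NavierStokesRegularity.Theorems.SymmetryModuliCountSymmetricLiouvilleRotationCovariance

/-!
# Route `HalfSpaceWindowDoor`, crux `CirculationCarryingRigidity` (stmt-NavierStokesRegularity-25311) —
# census brick: the PERIODIC STRATUM IS EMPTY (in every direction, with or without the sign)

LEAD ns-hsw-p1 g7 (cell pub-ns-dss), `--supports stmt-NavierStokesRegularity-25311 --as helper`.  Both census cards of the
crux (`Cruxes/CirculationCarryingRigidity/Lines/eddy_torque.md` §Next (2), `Lines/gauss_swirl.md` §Next (c)) name the
`z`-periodic / `z`-decaying profiles as the candidate next dead stratum of the research stub `stub_layerExclusion`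
(≡ `HemisphereLiouvilleE3`, W6).  This file settles the periodic half, for EVERY period direction and for a reason that does
not involve the closed-hemisphere sign at all: the route's Type-I ancient Oseen-mild class contains NO non-zero profile that
is periodic in some direction.

* `farPast_small_of_periodic` — a door-class profile (Type-I time rate `‖v(t,·)‖ ≤ C/√(−t)`, continuity on the open slab,
  unit-viscosity Oseen–Duhamel identity between negative times, divergence-free slices) with `v(t, x + e) = v(t, x)` for
  one `e ≠ 0` has `√(−t)‖v(t,x)‖ → 0` as `t → −∞`, uniformly in `x`.  This is the tree's blow-down lever
  `SymmetryModuliCountSymmetricLiouville.stub_periodicBlowdownVanishing` (line `blowdown-kills-pitch` of crux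
  `SymmetricLiouville`: the blow-downs `λ v(λ² s, x + λ y)`, `λ = √(−t) → ∞`, have periods `e/λ → 0`, an F3-limit is invariant
  under the whole line `ℝe`, and KNSS 2009 Thm 5.1 + Rem 6.1 + the caloric axial half — the tree's PROVED
  `KNSS2009_typeI_rate_liouville_holds` — kill it), fed with the PROVED F3 compactness of the class
  (`exists_tendsto_of_isTypeIAncientMild_seq`) and its rotation covariance (`stub_rotationCovariance`), after the bridge
  `isTypeIAncientMild_of_class`.
* `eq_zero_of_periodic` — hence `v ≡ 0` on the open lower slab: far-past smallness at every early time is «frequently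
  small», and `PoloidalWindowDoorPoloidalWindowRigidityForwardSmallness.eq_zero_of_frequently_small` (forward smallness from
  one slice + backward ε-regularity) ends.
* `curl_eq_zero_of_periodic`, `inner_curl_e3_eq_zero_of_periodic` — the census row in the vocabulary of W6: periodic
  door-class profiles are poloidal (indeed irrotational, indeed zero); `hemisphereLiouvilleE3_of_periodic` — W6 restricted to
  the periodic stratum, in the bundled vocabulary `InDoorClass` of `…Defs`.
* `not_isBackwardSingularPoint_of_periodic` — the same in the vocabulary of the crux: a periodic door-class profile is not
  backward singular at the apex.

Census meaning.  The enemy of W6 (a circulation-carrying closed-hemisphere Type-I ancient profile) has NO spatial period: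
not along the axis `e₃` (the `z`-periodic stratum of the cards), not along any horizontal or oblique direction; in
particular it is not helically symmetric with a rational pitch angle (such a profile is periodic along its axis).  The
`z`-DECAYING half of the cards' suggestion is untouched by this argument (blow-downs of a `z`-decaying profile need not be
line-invariant).

WHAT THIS IS NOT: not a statement about Navier–Stokes regularity (Clay A); door statements are regularity CRITERIA about
HYPOTHETICAL blow-up profiles (KNSS ancient mild solutions).  No item is closed by this file; the crux 25311 stays OPEN at its
research stub.
-/

noncomputable section

-- the summit and its single sub-problem share the name (CONVENTIONS §1), as in every Theorems file
set_option linter.dupNamespace false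

namespace Summit.NavierStokesRegularity.NavierStokesRegularity.Theorems.HalfSpaceWindowDoorCirculationCarryingRigidityPeriodicStratum

open MeasureTheory Set Function Filter Topology
open scoped RealInnerProductSpace InnerProductSpace
open Literature.Analysis Literature.Analysis.FluidPDE
open Summit.NavierStokesRegularity.NavierStokesRegularity.Theses.HalfSpaceWindowDoor
open Summit.NavierStokesRegularity.NavierStokesRegularity.Theorems.HalfSpaceWindowDoorCirculationCarryingRigidityDefs
open Summit.NavierStokesRegularity.NavierStokesRegularity.Theorems.PoloidalWindowDoorPoloidalWindowRigidityWindow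
  (isTypeIAncientMild_of_class)
open Summit.NavierStokesRegularity.NavierStokesRegularity.Theorems.PoloidalWindowDoorPoloidalWindowRigidityForwardSmallness
  (eq_zero_of_frequently_small)
open Summit.NavierStokesRegularity.NavierStokesRegularity.Theorems (exists_tendsto_of_isTypeIAncientMild_seq)
open Summit.NavierStokesRegularity.NavierStokesRegularity.Theorems.SymmetryModuliCountSymmetricLiouville
  (stub_periodicBlowdownVanishing stub_rotationCovariance)

variable {C : ℝ} {v : ℝ → EuclideanSpace ℝ (Fin 3) → EuclideanSpace ℝ (Fin 3)}

/-- **F3 — sequential compactness of the Type-I ancient mild class at constant `C`, slice-wise locally uniform form**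
(the hypothesis `hF3` of `stub_periodicBlowdownVanishing`), read off the tree's `C¹_loc` compactness theorem
`exists_tendsto_of_isTypeIAncientMild_seq`. -/
theorem F3_of_tree (C : ℝ) :
    ∀ w : ℕ → ℝ → EuclideanSpace ℝ (Fin 3) → EuclideanSpace ℝ (Fin 3), (∀ n, IsTypeIAncientMild C (w n)) →
      ∃ (φ : ℕ → ℕ) (W : ℝ → EuclideanSpace ℝ (Fin 3) → EuclideanSpace ℝ (Fin 3)), StrictMono φ ∧
        IsTypeIAncientMild C W ∧ ∀ t < 0, TendstoLocallyUniformly (fun n => w (φ n) t) (W t) atTop := by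
  intro w hw
  obtain ⟨φ, hφ, W, hW, -, -, hloc, -⟩ := exists_tendsto_of_isTypeIAncientMild_seq C hw
  exact ⟨φ, W, hφ, hW, hloc⟩

/-- **Far-past smallness of periodic door-class profiles.**  A profile of the route's Type-I ancient Oseen-mild class
that is periodic in some direction `e ≠ 0` has scale-invariant size `√(−t)‖v(t, x)‖ ≤ ε` for all `x`, at every time
`t` below some `T(ε) < 0` (blow-down kills the pitch: `stub_periodicBlowdownVanishing` with F3 and rotation covariance of
the class, both proved in the tree). -/
theorem farPast_small_of_periodic (hrate : HasTypeITimeDecay C v)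
    (hcont : ContinuousOn (uncurry v) (Iio (0 : ℝ) ×ˢ univ))
    (hmild : ∀ s t : ℝ, s < t → t < 0 → ∀ x,
      v t x = UnboundedOperators.heatExtension (v s) (t - s) x - oseenDuhamel 1 s v v t x)
    (hdiv : ∀ t < 0, VectorCalculus.IsDivFree (v t))
    {e : EuclideanSpace ℝ (Fin 3)} (he : e ≠ 0) (hper : ∀ t < 0, ∀ x, v t (x + e) = v t x) :
    ∀ ε > 0, ∃ T < 0, ∀ t < T, ∀ x, Real.sqrt (-t) * ‖v t x‖ ≤ ε :=
  stub_periodicBlowdownVanishing C (F3_of_tree C) (stub_rotationCovariance C) v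
    (isTypeIAncientMild_of_class hrate hcont hmild hdiv) e he hper

/-- **The periodic stratum of the door class is `{0}`.**  A profile of the route's Type-I ancient Oseen-mild class that is
periodic in some direction `e ≠ 0` vanishes identically on the open lower slab: far-past smallness
(`farPast_small_of_periodic`) makes it frequently small, and forward smallness from one slice + backward ε-regularity
(`eq_zero_of_frequently_small`) end.  The closed-hemisphere sign is not needed. -/
theorem eq_zero_of_periodic (hrate : HasTypeITimeDecay C v)
    (hcont : ContinuousOn (uncurry v) (Iio (0 : ℝ) ×ˢ univ))
    (hmild : ∀ s t : ℝ, s < t → t < 0 → ∀ x,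
      v t x = UnboundedOperators.heatExtension (v s) (t - s) x - oseenDuhamel 1 s v v t x)
    (hdiv : ∀ t < 0, VectorCalculus.IsDivFree (v t))
    {e : EuclideanSpace ℝ (Fin 3)} (he : e ≠ 0) (hper : ∀ t < 0, ∀ x, v t (x + e) = v t x) :
    ∀ t < 0, ∀ x, v t x = 0 := by
  refine eq_zero_of_frequently_small hrate hmild fun ε hε T => ?_
  obtain ⟨T₀, hT₀, h⟩ := farPast_small_of_periodic hrate hcont hmild hdiv he hper ε hε
  refine ⟨min T T₀ - 1, by linarith [min_le_left T T₀], fun x => ?_⟩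
  exact h _ (by linarith [min_le_right T T₀]) x

/-- **Periodic door-class profiles are irrotational** (indeed zero): every vorticity slice vanishes. -/
theorem curl_eq_zero_of_periodic (hrate : HasTypeITimeDecay C v)
    (hcont : ContinuousOn (uncurry v) (Iio (0 : ℝ) ×ˢ univ))
    (hmild : ∀ s t : ℝ, s < t → t < 0 → ∀ x,
      v t x = UnboundedOperators.heatExtension (v s) (t - s) x - oseenDuhamel 1 s v v t x)
    (hdiv : ∀ t < 0, VectorCalculus.IsDivFree (v t))
    {e : EuclideanSpace ℝ (Fin 3)} (he : e ≠ 0) (hper : ∀ t < 0, ∀ x, v t (x + e) = v t x) :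
    ∀ s < 0, ∀ y, curl (v s) y = 0 := by
  intro s hs y
  have heq : v s = fun _ => (0 : EuclideanSpace ℝ (Fin 3)) :=
    funext fun x => eq_zero_of_periodic hrate hcont hmild hdiv he hper s hs x
  rw [heq]
  ext i
  fin_cases i <;> simp [curl]

/-- **CENSUS ROW (W6 on the periodic stratum, sign-free).**  A profile of the route's Type-I ancient Oseen-mild class that
is periodic in some direction `e ≠ 0` is poloidal along `e₃`: `⟪curl v(s), e₃⟫ ≡ 0`.  (The hypothesis `⟪curl v, e₃⟫ ≥ 0` of
`HemisphereLiouvilleE3` is not needed and not assumed.) -/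
theorem inner_curl_e3_eq_zero_of_periodic (hrate : HasTypeITimeDecay C v)
    (hcont : ContinuousOn (uncurry v) (Iio (0 : ℝ) ×ˢ univ))
    (hmild : ∀ s t : ℝ, s < t → t < 0 → ∀ x,
      v t x = UnboundedOperators.heatExtension (v s) (t - s) x - oseenDuhamel 1 s v v t x)
    (hdiv : ∀ t < 0, VectorCalculus.IsDivFree (v t))
    {e : EuclideanSpace ℝ (Fin 3)} (he : e ≠ 0) (hper : ∀ t < 0, ∀ x, v t (x + e) = v t x) :
    ∀ s < 0, ∀ y, ⟪curl (v s) y, e3⟫ = 0 := by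
  intro s hs y
  rw [curl_eq_zero_of_periodic hrate hcont hmild hdiv he hper s hs y, inner_zero_left]

/-- **W6 restricted to the periodic stratum, bundled form.**  In the vocabulary of `…Defs`: every door-class profile
(`InDoorClass C v`) with a spatial period `e ≠ 0` satisfies the conclusion of `HemisphereLiouvilleE3`. -/
theorem hemisphereLiouvilleE3_of_periodic (hv : InDoorClass C v)
    {e : EuclideanSpace ℝ (Fin 3)} (he : e ≠ 0) (hper : ∀ t < 0, ∀ x, v t (x + e) = v t x) :
    ∀ s < 0, ∀ y, ⟪curl (v s) y, e3⟫ = 0 :=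
  inner_curl_e3_eq_zero_of_periodic hv.1 hv.2.1 hv.2.2.1 hv.2.2.2 he hper

/-- **The crux on the periodic stratum.**  A profile of the route's Type-I ancient Oseen-mild class that is periodic in some
direction `e ≠ 0` is not backward singular at the apex `(0, 0)` (it vanishes on the open lower slab, so its `L^∞` norm on
every backward parabolic cylinder at the apex is `0`, not `∞`). -/
theorem not_isBackwardSingularPoint_of_periodic (hrate : HasTypeITimeDecay C v)
    (hcont : ContinuousOn (uncurry v) (Iio (0 : ℝ) ×ˢ univ))
    (hmild : ∀ s t : ℝ, s < t → t < 0 → ∀ x,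
      v t x = UnboundedOperators.heatExtension (v s) (t - s) x - oseenDuhamel 1 s v v t x)
    (hdiv : ∀ t < 0, VectorCalculus.IsDivFree (v t))
    {e : EuclideanSpace ℝ (Fin 3)} (he : e ≠ 0) (hper : ∀ t < 0, ∀ x, v t (x + e) = v t x) :
    ¬ IsBackwardSingularPoint v 0 := by
  intro hsing
  have h0 := eq_zero_of_periodic hrate hcont hmild hdiv he hper
  have hnorm : eLpNorm (uncurry v) ⊤
      (volume.restrict (parabolicCylinder 1 (0 : ℝ × EuclideanSpace ℝ (Fin 3)))) = 0 := by
    rw [eLpNorm_congr_ae (g := 0) ?_, eLpNorm_zero]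
    filter_upwards [ae_restrict_mem (isOpen_parabolicCylinder _ _).measurableSet] with w hw
    have hw0 : w.1 < 0 := by
      rw [mem_parabolicCylinder] at hw
      simpa using hw.1.2
    exact h0 w.1 hw0 w.2
  have htop := hsing 1 one_pos
  rw [hnorm] at htop
  exact ENNReal.zero_ne_top htop

end Summit.NavierStokesRegularity.NavierStokesRegularity.Theorems.HalfSpaceWindowDoorCirculationCarryingRigidityPeriodicStratum

end
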